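import Literature.AlgebraicGeometry.HodgeTheory.CyclicCoverPencilMonodromyMapInverse
import Literature.AlgebraicGeometry.HodgeTheory.CyclicCoverPencilLocalMonodromy
import Literature.AlgebraicGeometry.HodgeTheory.CyclicCoverPencilFoldIsotopyInvariant
import Literature.AlgebraicGeometry.HodgeTheory.NodalFormPencilNonsingular
import Literature.AlgebraicGeometry.HodgeTheory.CyclicCoverBaseChart
import Literature.AlgebraicGeometry.Motives.UniversalHypersurfaceRegularLocusChart
import Literature.AlgebraicGeometry.Motives.UniversalHypersurfaceRegularLocusChartTarget
import Literature.Geometry.ComplexAnalytic.CyclicNodePencilMorseChart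
import Mathlib.Analysis.Calculus.BumpFunction.FiniteDimension
import Mathlib.Analysis.Calculus.ContDiff.RCLike
import Mathlib.FieldTheory.IsAlgClosed.Basic
import Literature.AlgebraicGeometry.HodgeTheory.CyclicCoverPencilTransport
import Literature.AlgebraicGeometry.HodgeTheory.LocalMonodromyDatumConjugate
import Literature.AlgebraicGeometry.HodgeTheory.NodalTernaryFormUninodal
import HarnessLib

/-!
# The geometric monodromy package of the nodal pencil `x₃^p = f₁ + c·x₂^p` and the rational transport datum of its circle
# (towards Carlson–Toledo 1999, §6)

V. I. Arnold, S. M. Gusein-Zade, A. N. Varchenko, *Singularities of Differentiable Maps II* (2012), Part I §1.1, §2.1; J. Milnor,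
*Singular Points of Complex Hypersurfaces*, §9; J. A. Carlson, D. Toledo, Duke Math. J. 97 (1999), §6.  Second file of the
Literature-side proof of `HodgeTheory.carlsonToledo1999_nodalMeridianLocalMonodromyBound` (after `HodgeTheory/NodalTernaryFormUninodal`).
The construction of the geometric monodromy of the pencil `x₃^p = f₁ + c·x₂^p`, `f₁ = x₂^{p−2}x₀x₁ + x₀^p + x₁^p`, around its nodal
member `c = 0` was carried out in the Literature layer relative to a list of constants (a holomorphic Morse chart, radii, cut-offs,
base fields, the chart of the regular locus, the disc radius: `HodgeTheory/CyclicCoverPencil*`, `Geometry/ComplexAnalytic/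
CyclicNodePencilMorseChart`).

* Part 1 (namespace `…CyclicCoverMonodromy.NodalPencilPackage`) — `formOfCoeffs` of the pencil members (`formOfCoeffs_nodalPencil`),
  the non-singularity radius (`exists_nonsingular_radius`: for `0 < |c| < ε₁` the member is a non-singular quaternary form), and
  **`exists_nodalPencil_monodromy_package`** — all constants CHOSEN: `δ₀ > 0` and self-maps `h, k` of `ℝ × S` (continuity,
  `h(0, ·) = id`, rotation of the pencil coordinate by `e^{±2πiu}`, two-sided inverses) such that for every `0 < |c| < δ₀` the
  time-one map restricted to `X_c` carries the local-monodromy datum `∃ V, (T−1)H² ⊆ V, Σ_{i<p} Tⁱ|_V = 0, dim V ≤ p − 1` for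
  `T = h(1, ·)^*` on `H²(X_c; ℚ)`;
* Part 2 (namespace `…CyclicCoverMonodromy.NodalPencilCircleDatum`) — `pow_apply_symm_pow_apply`, `exists_localMonodromyDatum_symm`
  (the datum for the inverse map) and **`exists_isRatTransport_datum_pencilCircle`**: the rational transport of `R² u_* ℚ` along
  the pencil circle of radius `< δ₀` exists and carries the local-monodromy datum.

Theorems only: no definition, no named fact.

Provenance: Literature home (namespace `Literature.AlgebraicGeometry.HodgeTheory.CyclicCoverMonodromy.*`) of the Summits-side
`HodgeConjecture/Theorems/CyclicUnitaryPowersNodalPencilPackage` and `…/CyclicUnitaryPowersNodalPencilCircleDatum` (route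
`CyclicUnitaryPowers`; imports `Literature/` and Mathlib only), which `Literature/` may not import. Lane `lit-hodgefound`, seat p20.

## References

* [ArnoldGuseinzadeVarchenko2012] V. I. Arnold, S. M. Gusein-Zade, A. N. Varchenko, *Singularities of Differentiable Maps II*
  (2012), Part I §1.1, §2.1 and §2.3 Thm. 2.2.
* [Milnor1968] J. Milnor, *Singular Points of Complex Hypersurfaces* (1968), §9.
* [CarlsonToledo1999] J. A. Carlson, D. Toledo, *Discriminant complements and kernels of monodromy representations*, Duke Math.
  J. 97 (1999), §2, §6.
* [VoisinHodgeII2003] C. Voisin, *Hodge Theory and Complex Algebraic Geometry II* (2003), §2.3.1–§2.3.2.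
-/

/-! ## Part 1: The nodal pencil: non-singular radius and the local monodromy package -/

noncomputable section

open _root_.CategoryTheory _root_.AlgebraicGeometry MvPolynomial TopologicalSpace Set _root_.Topology Filter Complex Metric
open scoped Manifold ContDiff Real
open Literature.AlgebraicGeometry.Motives Literature.AlgebraicGeometry.Motives.UniversalHypersurface
open Literature.AlgebraicGeometry.HodgeTheory Literature.AlgebraicGeometry.HodgeTheory.UniversalHypersurface
open Literature.Geometry.ComplexAnalytic Literature.Geometry.Manifold
open Literature.AlgebraicTopology.SingularHomology
open Literature.AlgebraicGeometry.HodgeTheory.CyclicCoverMonodromy.UninodalTernaryForm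

namespace Literature.AlgebraicGeometry.HodgeTheory.CyclicCoverMonodromy.NodalPencilPackage

/-! ### §1 The nonsingularity radius of the pencil -/

/-- `formOfCoeffs` is compatible with subtraction. [cite: VoisinHodgeII2003, §6.2.1] -/
theorem formOfCoeffs_sub {n d : ℕ} (a b : DegIndex n d → ℂ) : formOfCoeffs (a - b) = formOfCoeffs a - formOfCoeffs b := by
  simp [formOfCoeffs_def, Finset.sum_sub_distrib]

/-- `formOfCoeffs (e_m c) = c·x^m`. [cite: VoisinHodgeII2003, §6.2.1] -/
theorem formOfCoeffs_single {n d : ℕ} (m : DegIndex n d) (c : ℂ) : formOfCoeffs (Pi.single m c) = monomial m.1 c := by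
  classical
  rw [formOfCoeffs_def, Finset.sum_eq_single m (fun b _ hb => by rw [Pi.single_eq_of_ne hb, monomial_zero])
    (fun h => absurd (Finset.mem_univ m) h), Pi.single_eq_same]

/-- **The quaternary form with coefficient vector `b₀ − c·e_{x₂^p}` is `x₃^p − (f₁ + c x₂^p)`** (`p ≥ 3`).
[cite: CarlsonToledo1999, §6 (kdoublept)] -/
theorem formOfCoeffs_nodalPencil {p : ℕ} (hp : 3 ≤ p) (c : ℂ) :
    formOfCoeffs (coeffsOf 2 p (cyclicCoverForm p (X 2 ^ (p - 2) * (X 0 * X 1) + X 0 ^ p + X 1 ^ p)) -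
        Pi.single (regPowIndex 2 p 2) c) =
      cyclicCoverForm p ((X 2 ^ (p - 2) * (X 0 * X 1) + X 0 ^ p + X 1 ^ p) + c • X 2 ^ p) := by
  obtain ⟨m, rfl⟩ : ∃ m, p = m + 3 := ⟨p - 3, by omega⟩
  have hpm : m + 3 - 2 = m + 1 := by omega
  rw [hpm, formOfCoeffs_sub, formOfCoeffs_single,
    formOfCoeffs_coeffsOf 2 (m + 3) (CyclicCoverFormNonsingular.isHomogeneous_cyclicCoverForm_of_isHomogeneous
      (isHomogeneous_nodalTernaryForm m))]
  simp only [cyclicCoverForm_def, smul_eq_C_mul, map_add, map_mul, map_pow, rename_X, rename_C]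
  rw [show (regPowIndex 2 (m + 3) 2).1 = Finsupp.single (2 : Fin 4) (m + 3) from rfl, ← C_mul_X_pow_eq_monomial,
    show (Fin.castSucc (2 : Fin 3) : Fin 4) = 2 from rfl]
  ring

/-- **The nonsingularity radius**: for `0 < |c| < ε₁` the member `x₃^p = f₁ + c x₂^p` is a nonsingular quaternary form (`p ≥ 3`;
Voisin II §2.3: nodal members of a pencil are isolated in the discriminant — the tree's `NodalFormPencilNonsingular`, plus "`x₃^p − f` is
nonsingular iff `f` is"). [cite: VoisinHodgeII2003, §2.3.1 and §2.3.2] [cite: CarlsonToledo1999, §2 (held text p0004)] -/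
theorem exists_nonsingular_radius {p : ℕ} (hp : 3 ≤ p) :
    ∃ ε₁ : ℝ, 0 < ε₁ ∧ ∀ c : ℂ, c ≠ 0 → ‖c‖ < ε₁ → SmoothHypersurface.IsNonsingularForm ℂ (formOfCoeffs
      (coeffsOf 2 p (cyclicCoverForm p (X 2 ^ (p - 2) * (X 0 * X 1) + X 0 ^ p + X 1 ^ p)) - Pi.single (regPowIndex 2 p 2) c)) := by
  obtain ⟨m, rfl⟩ : ∃ m, p = m + 3 := ⟨p - 3, by omega⟩
  have hpm : m + 3 - 2 = m + 1 := by omega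
  have hg : (X 2 ^ (m + 3) : MvPolynomial (Fin 3) ℂ).IsHomogeneous (m + 3) := by
    simpa using (isHomogeneous_X ℂ (2 : Fin 3)).pow (m + 3)
  obtain ⟨ε₁, hε₁, hns⟩ := (isNodalFormWithNodes_nodalTernaryForm m).exists_isNonsingularForm_add_smul (by omega)
    (isHomogeneous_nodalTernaryForm m) hg (fun i => by simp)
  refine ⟨ε₁, hε₁, fun c hc0 hcε => ?_⟩
  rw [formOfCoeffs_nodalPencil hp, hpm, isNonsingularForm_cyclicCoverForm_iff (by omega)]
  exact hns c hc0 hcε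

/-! ### §2 The package -/

set_option maxHeartbeats 1600000 in
/-- **The geometric monodromy package of the nodal pencil** (`p ≥ 3`). There are `δ₀ > 0` and self-maps `h, k` of `ℝ × S`
(`S = pencilSlice p`) such that: `h` is continuous on `ℝ × {c ≠ 0}`; `h(0, ·) = id` on `{c ≠ 0}`; over the punctured disc
`0 < |c| < δ₀`, `c(h(u, x)) = e^{2πiu}c(x)`, `k(u, h(u, x)) = x`, `h(u, k(u, x)) = x`, `c(k(u, x)) = e^{−2πiu}c(x)`; and for every
`0 < |c| < δ₀` the time-one map restricts to a continuous self-map `hY` of the member `X_c = pencilFibre p c` such that every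
automorphism `T` of `H²(X_c; ℚ)` with `T = hY^*` carries the local-monodromy datum.
[cite: ArnoldGuseinzadeVarchenko2012, Part I §1.1 and §2.1 (held text p0013, p0025)] [cite: Milnor1968, §9 Thm. 9.1 and Lemma 9.4]
[cite: CarlsonToledo1999, §6 (kdoublept) (held text p0013–p0014)] -/
theorem exists_nodalPencil_monodromy_package {p : ℕ} (hp : 3 ≤ p) :
    ∃ (δ₀ : ℝ) (h k : ℝ × pencilSlice p → pencilSlice p), 0 < δ₀ ∧
      (Continuous fun ux : ℝ × {x : pencilSlice p // pencilCoord p x.1 ≠ 0} => h (ux.1, ux.2.1)) ∧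
      (∀ x, pencilCoord p x.1 ≠ 0 → h (0, x) = x) ∧
      (∀ u x, pencilCoord p x.1 ≠ 0 → ‖pencilCoord p x.1‖ < δ₀ →
        pencilCoord p (h (u, x)).1 = Complex.exp (((2 * π * u : ℝ) : ℂ) * I) * pencilCoord p x.1 ∧
        k (u, h (u, x)) = x ∧ h (u, k (u, x)) = x ∧
        pencilCoord p (k (u, x)).1 = Complex.exp (((-(2 * π * u) : ℝ) : ℂ) * I) * pencilCoord p x.1) ∧
      (∀ c : ℂ, c ≠ 0 → ‖c‖ < δ₀ → ∃ hY : C(↥(pencilFibre p c), ↥(pencilFibre p c)),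
        (∀ y : ↥(pencilFibre p c), ((hY y : ↥(pencilFibre p c)) : ComplexPoints (regularTotal ℂ 2 p)) = (h (1, ⟨y.1, y.2.1⟩)).1) ∧
        ∀ τ : singularCohomology ℚ ℚ ↥(pencilFibre p c) 2 ≃ₗ[ℚ] singularCohomology ℚ ℚ ↥(pencilFibre p c) 2,
          (∀ x, τ x = (singularCohomology.map ℚ ℚ hY 2).hom x) →
          ∃ V : Submodule ℚ (singularCohomology ℚ ℚ ↥(pencilFibre p c) 2),
            (∀ x, τ x - x ∈ V) ∧ (∀ v ∈ V, (∑ i ∈ Finset.range p, (τ ^ i) v) = 0) ∧ Module.finrank ℚ V ≤ p - 1) := by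
  have hp0 : p ≠ 0 := by omega
  have hd : 0 < p := by omega
  set b₀ := coeffsOf 2 p (cyclicCoverForm p (X 2 ^ (p - 2) * (X 0 * X 1) + X 0 ^ p + X 1 ^ p)) with hb₀
  set m₀ : DegIndex 2 p := regPowIndex 2 p 2 with hm₀
  ------------------------------------------------------------------
  -- (1) the Morse chart and the radii
  ------------------------------------------------------------------
  obtain ⟨Θ, h0s, hΘ0, -, hΘ, hΘs, hΘφ, -⟩ := PhamBrieskorn.exists_cyclicNodePencil_morseChart hp
  obtain ⟨ρ, hρ, hρt⟩ := Metric.isOpen_iff.mp Θ.open_target 0 (by rw [← hΘ0]; exact Θ.map_source h0s)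
  set r : ℝ := ρ / 2 with hr_def
  have hr0 : 0 < r := by positivity
  have hrt : {z : Fin (1 + 2) → ℂ | ∑ i, ‖z i‖ ^ 2 ≤ r ^ 2} ⊆ Θ.target := by
    intro z hz
    refine hρt (mem_ball_zero_iff.mpr ((pi_norm_lt_iff hρ).mpr fun i => ?_))
    have hi : ‖z i‖ ^ 2 ≤ r ^ 2 :=
      le_trans (Finset.single_le_sum (fun j _ => sq_nonneg ‖z j‖) (Finset.mem_univ i)) hz
    have : ‖z i‖ ≤ r := le_of_sq_le_sq hi hr0.le
    linarith
  set R'' : ℝ := r ^ 2 with hR''_def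
  have hR''t : {z : Fin (1 + 2) → ℂ | ∑ i, ‖z i‖ ^ 2 ≤ R''} ⊆ Θ.target := hrt
  set R''' : ℝ := r ^ 2 / 2 with hR'''_def
  have hR : R''' < R'' := by rw [hR'''_def, hR''_def]; nlinarith
  have hR'''0 : 0 < R''' := by positivity
  set r₂ : ℝ := min (min (1 / 2) (1 / p)) (R''' / 2) with hr₂_def
  have hr₂0 : 0 < r₂ := by positivity
  have hr₂h : r₂ ≤ 1 / 2 := (min_le_left _ _).trans (min_le_left _ _)
  have hr₂1 : r₂ < 1 := by linarith
  have hr₂p : r₂ ≤ 1 / p := (min_le_left _ _).trans (min_le_right _ _)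
  have hr₂R : r₂ ≤ R''' / 2 := min_le_right _ _
  have hr₂' : r₂ ^ (p - 2) < 2 / p := by
    have h1 : r₂ ^ (p - 2) ≤ r₂ := pow_le_of_le_one hr₂0.le hr₂1.le (by omega)
    have h2 : (1 : ℝ) / p < 2 / p := div_lt_div_of_pos_right (by norm_num) (by exact_mod_cast hd)
    linarith
  have hr₂sq : r₂ ^ 2 < R''' := by
    have h1 : r₂ ^ 2 ≤ r₂ := pow_le_of_le_one hr₂0.le hr₂1.le two_ne_zero
    linarith
  set s₁ : ℝ := r₂ / 2 with hs₁_def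
  set s₀ : ℝ := r₂ / 4 with hs₀_def
  have hs₀ : 0 < s₀ := by positivity
  have hsr : s₀ ≤ r₂ := by rw [hs₀_def]; linarith
  have hs₀₁ : s₀ ^ 2 < s₁ ^ 2 := by rw [hs₀_def, hs₁_def]; nlinarith
  have hs₁r : s₁ ^ 2 < r₂ ^ 2 := by rw [hs₁_def]; nlinarith
  set T : ℝ := r₂ ^ 2 with hT_def
  set T' : ℝ := r₂ ^ 2 / 2 with hT'_def
  set t₁ : ℝ := s₁ ^ 2 with ht₁_def
  set t₂ : ℝ := 3 * r₂ ^ 2 / 8 with ht₂_def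
  have hT0 : 0 < T := by positivity
  have hT'0 : 0 < T' := by positivity
  have hTR : T ≤ R''' := hr₂sq.le
  have hTr : T ≤ r ^ 2 := by rw [hT_def]; linarith
  have hTr₂ : T ≤ r₂ ^ 2 := le_rfl
  have ht₁ : s₁ ^ 2 ≤ t₁ := le_rfl
  have ht₁₂ : t₁ < t₂ := by rw [ht₁_def, ht₂_def, hs₁_def]; nlinarith
  have ht₂T' : t₂ < T' := by rw [ht₂_def, hT'_def]; nlinarith
  have hT'T : T' < T := by rw [hT'_def, hT_def]; nlinarith
  set δ : ℝ := s₀ ^ p / 2 with hδ_def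
  have hδ0 : 0 < δ := by positivity
  have hδ : δ < s₀ ^ p := by rw [hδ_def]; linarith [pow_pos hs₀ p]
  ------------------------------------------------------------------
  -- (2) the node cut-off `β`
  ------------------------------------------------------------------
  have hUo : IsOpen (Θ.source ∩ {x | ∑ i, ‖Θ x i‖ ^ 2 < s₀ ^ 2}) := PhamBrieskorn.isOpen_chartBall Θ
  have h0U : (0 : Fin (1 + 2) → ℂ) ∈ Θ.source ∩ {x | ∑ i, ‖Θ x i‖ ^ 2 < s₀ ^ 2} :=
    ⟨h0s, by rw [mem_setOf_eq, hΘ0]; simp [pow_pos hs₀ 2]⟩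
  obtain ⟨η₀, hη₀, hη₀U⟩ := Metric.isOpen_iff.mp hUo 0 h0U
  set η : ℝ := η₀ / 3 with hη_def
  have hη : 0 < η := by positivity
  let β : ContDiffBump (0 : Fin (2 + 1) → ℂ) := ⟨η, 2 * η, hη, by linarith⟩
  have hβ : ContDiff ℝ ∞ β := β.contDiff
  have hβR : ∀ y : Fin (2 + 1) → ℂ, 2 * η < ‖y‖ → β y = 0 := fun y hy =>
    β.zero_of_le_dist (by rw [dist_zero_right]; exact hy.le)
  have hβ1 : ∀ y : Fin (2 + 1) → ℂ, ‖y‖ < η → β y = 1 := fun y hy =>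
    β.one_of_mem_closedBall (by rw [mem_closedBall, dist_zero_right]; exact hy.le)
  have hβs : ∀ y : Fin (2 + 1) → ℂ, β y ≠ 0 → y ∈ Θ.source ∧ ∑ i, ‖Θ y i‖ ^ 2 < s₀ ^ 2 := by
    intro y hy
    have hmem : y ∈ Function.support (β : (Fin (2 + 1) → ℂ) → ℝ) := hy
    rw [β.support_eq] at hmem
    have hyball : y ∈ ball (0 : Fin (2 + 1) → ℂ) η₀ := by
      rw [mem_ball] at hmem ⊢
      change dist y 0 < 2 * η at hmem
      linarith
    exact hη₀U hyball
  ------------------------------------------------------------------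
  -- (3) the base cut-off `χ'`, the disc radius, the base fields
  ------------------------------------------------------------------
  obtain ⟨V, hVo, hb₀V, hV⟩ := exists_coeff_nhds_singular_subset_nodeNbhd p (η := η) hp hη
  obtain ⟨ρV, hρV, hρVV⟩ := Metric.isOpen_iff.mp hVo b₀ hb₀V
  set ρK : ℝ := min (ρV / 2) δ with hρK_def
  have hρK0 : 0 < ρK := by positivity
  have hρδ : ρK ≤ δ := min_le_right _ _
  set K : Set (DegIndex 2 p → ℂ) := closedBall b₀ ρK with hK_def
  have hK : IsCompact K := isCompact_closedBall _ _
  have hKV : K ⊆ V := (closedBall_subset_ball (by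
    rw [hρK_def]; exact lt_of_le_of_lt (min_le_left _ _) (by linarith))).trans hρVV
  let χ : ContDiffBump b₀ := ⟨ρK / 2, ρK, by positivity, by linarith⟩
  have hχ : ContDiff ℝ ∞ χ := χ.contDiff
  have hχK0 : ∀ b, b ∉ K → χ b = 0 := fun b hb =>
    χ.zero_of_le_dist (by rw [hK_def, mem_closedBall] at hb; exact (not_le.mp hb).le)
  have hχK : ∀ b, χ b ≠ 0 → ‖b - b₀‖ < ρK := by
    intro b hb
    have hmem : b ∈ Function.support (χ : (DegIndex 2 p → ℂ) → ℝ) := hb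
    rw [χ.support_eq, mem_ball, dist_eq_norm] at hmem
    exact hmem
  obtain ⟨ε₁, hε₁, hns₁⟩ := exists_nonsingular_radius hp
  set ρW : ℝ := min (ρK / 2) ε₁ with hρW_def
  have hρW : 0 < ρW := by positivity
  have hχ1 : ∀ b, ‖b - b₀‖ < ρW → χ b = 1 := fun b hb =>
    χ.one_of_mem_closedBall (by
      rw [mem_closedBall, dist_eq_norm]
      exact (hb.trans_le (min_le_left _ _)).le)
  have hns : ∀ c : ℂ, c ≠ 0 → ‖c‖ < ρW →
      SmoothHypersurface.IsNonsingularForm ℂ (formOfCoeffs (b₀ - Pi.single m₀ c)) :=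
    fun c hc0 hc => hns₁ c hc0 (hc.trans_le (min_le_right _ _))
  let W₁ : (DegIndex 2 p → ℂ) → (DegIndex 2 p → ℂ) := fun _ => Pi.single m₀ (-1)
  let W₂ : (DegIndex 2 p → ℂ) → (DegIndex 2 p → ℂ) := fun _ => Pi.single m₀ (-I)
  have hW₁ : ContDiff ℝ ∞ W₁ := contDiff_const
  have hW₂ : ContDiff ℝ ∞ W₂ := contDiff_const
  have hW₁' : ∀ b (m : DegIndex 2 p), m ≠ m₀ → W₁ b m = 0 := fun b m hm => Pi.single_eq_of_ne hm _
  have hW₂' : ∀ b (m : DegIndex 2 p), m ≠ m₀ → W₂ b m = 0 := fun b m hm => Pi.single_eq_of_ne hm _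
  have hW₁u : ∀ b, ‖b - b₀‖ < ρW → W₁ b m₀ = -1 := fun b _ => Pi.single_eq_same _ _
  have hW₂u : ∀ b, ‖b - b₀‖ < ρW → W₂ b m₀ = -I := fun b _ => Pi.single_eq_same _ _
  -- Lipschitz bounds for the one-dimensional vector fields `v_w(z) = χ'(b₀ − z e_{m₀}) · w`
  obtain ⟨Cχ, hCχ⟩ := ContDiff.lipschitzWith_of_hasCompactSupport (𝕂 := ℝ) (n := 1) χ.hasCompactSupport χ.contDiff one_ne_zero
  have hA : LipschitzWith ‖(ContinuousLinearMap.single ℝ (fun _ : DegIndex 2 p => ℂ) m₀ : ℂ →L[ℝ] (DegIndex 2 p → ℂ))‖₊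
      (fun z : ℂ => b₀ - Pi.single m₀ z) := by
    have h := (ContinuousLinearMap.single ℝ (fun _ : DegIndex 2 p => ℂ) m₀).lipschitz
    have h2 := (LipschitzWith.const (α := ℂ) b₀).sub h
    simpa using h2
  have hLw : ∀ w : ℂ, LipschitzWith ‖((ContinuousLinearMap.id ℝ ℝ).smulRight w : ℝ →L[ℝ] ℂ)‖₊ fun x : ℝ => x • w := fun w =>
    ((ContinuousLinearMap.id ℝ ℝ).smulRight w).lipschitz
  have hv : ∀ w : ℂ, ∃ Kw : NNReal, LipschitzWith Kw (fun z : ℂ => (χ (b₀ - Pi.single m₀ z)) • w) := fun w =>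
    ⟨_, ((hLw w).comp hCχ).comp hA⟩
  obtain ⟨K₁, hK₁⟩ := hv 1
  obtain ⟨K₂, hK₂⟩ := hv I
  have hv₁ : LipschitzWith K₁ (fun z : ℂ => -((χ (b₀ - Pi.single m₀ z) : ℂ) * W₁ (b₀ - Pi.single m₀ z) m₀)) := by
    have heq : (fun z : ℂ => -((χ (b₀ - Pi.single m₀ z) : ℂ) * W₁ (b₀ - Pi.single m₀ z) m₀)) =
        fun z : ℂ => (χ (b₀ - Pi.single m₀ z)) • (1 : ℂ) := by
      funext z; simp [W₁, Complex.real_smul]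
    rw [heq]; exact hK₁
  have hv₂ : LipschitzWith K₂ (fun z : ℂ => -((χ (b₀ - Pi.single m₀ z) : ℂ) * W₂ (b₀ - Pi.single m₀ z) m₀)) := by
    have heq : (fun z : ℂ => -((χ (b₀ - Pi.single m₀ z) : ℂ) * W₂ (b₀ - Pi.single m₀ z) m₀)) =
        fun z : ℂ => (χ (b₀ - Pi.single m₀ z)) • I := by
      funext z; simp [W₂, Complex.real_smul]
    rw [heq]; exact hK₂
  ------------------------------------------------------------------
  -- (4) the fold isotopy
  ------------------------------------------------------------------
  obtain ⟨g, hgc, hg0, hg2π, hgO, hgadd, hgS, hgF⟩ := exists_pencil_foldIsotopy_invariant hp hΘ hΘs hΘφ hs₀ hsr hr₂1 hr₂'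
    hs₀₁ hs₁r hr₂sq hR hR''t hδ β hβ hβR hβ1 hβs χ hχ hK hKV hχK0 hV hχK hρδ hχ1 W₁ W₂ hW₁ hW₂ hW₁' hW₂' hW₁u hW₂u hv₁ hv₂
  have hgS' : ∀ θ q, q ∈ pencilSlice p → g (θ, q) ∈ pencilSlice p := fun θ q hq => hgS θ q hq
  have hgF' : ∀ θ q, q ∈ pencilSlice p → s₀ ^ 2 < satRadius p Θ R''' R'' q → satRadius p Θ R''' R'' q < r₂ ^ 2 →
      satRadius p Θ R''' R'' (g (θ, q)) = satRadius p Θ R''' R'' q := fun θ q hq => hgF θ q hq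
  ------------------------------------------------------------------
  -- (5) the chart of the regular locus
  ------------------------------------------------------------------
  have hne : (regChartDom 2 p 2).Nonempty := by
    -- the point with affine coordinates `(0, 0, y₂)`, `y₂^p = ρW/2`, of the member `c = ρW/2`
    obtain ⟨y₂, hy₂⟩ := IsAlgClosed.exists_pow_nat_eq ((ρW / 2 : ℝ) : ℂ) hd
    let y : Fin (2 + 1) → ℂ := fun j => if j = 2 then y₂ else 0
    have hφ : y 2 ^ p - (y 0 * y 1 + y 0 ^ p + y 1 ^ p) = ((ρW / 2 : ℝ) : ℂ) := by
      simp [y, zero_pow hp0, hy₂]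
    have hc0 : (((ρW / 2 : ℝ) : ℂ)) ≠ 0 := by exact_mod_cast (by positivity : ρW / 2 ≠ 0)
    have hcρ : ‖((ρW / 2 : ℝ) : ℂ)‖ < ρW := by
      rw [Complex.norm_real, Real.norm_eq_abs, abs_of_pos (by positivity)]; linarith
    have hv : SmoothHypersurface.IsNonsingularForm ℂ (formOfCoeffs (regChartCoeffVec 2 p 2
        (Sum.elim (fun m : {m : DegIndex 2 p // m ≠ regPowIndex 2 p 2} => b₀ m.1) y))) := by
      rw [regChartCoeffVec_nodalPencil_eq p hp, hφ]
      exact hns _ hc0 hcρ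
    obtain ⟨Q, hQ, -⟩ := exists_regChartFun_eq_of_nonsingular 2 p 2 hd _ hv
    exact ⟨Q, hQ⟩
  obtain ⟨Φ, hΦ, hΦs, hΦt, -, -⟩ := exists_regChart (n := 2) (d := p) (i := 2) hd hne
  ------------------------------------------------------------------
  -- (6) the disc radius `δ₀` and the monodromy map
  ------------------------------------------------------------------
  set τ : ℝ := min 1 (T' / 3) with hτ_def
  have hτ0 : 0 < τ := by positivity
  have hτ1 : τ ≤ 1 := min_le_left _ _
  have hτT : τ ≤ T' / 3 := min_le_right _ _
  set δ₀ : ℝ := min (ρW / 4) (τ ^ p) with hδ₀_def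
  have hδ₀0 : 0 < δ₀ := by positivity
  have hδ₀ : δ₀ ≤ ρW / 4 := min_le_left _ _
  have hδ₀τ : δ₀ ≤ τ ^ p := min_le_right _ _
  have hδρ : δ₀ ≤ ρW := by linarith
  obtain ⟨h, k, H, hhc, hh0, hhk, hh1, hHc, hH⟩ := exists_pencil_monodromyMap' hp Φ hΦ hΦs hΦt Θ hrt hΘφ hρW hns hR hTR hTr
    hT0 g hgc hg0 hg2π hgO hgadd hgS' hgF' hs₀₁ hTr₂ hδ₀ hΘ hR''t ht₁ ht₁₂ ht₂T'.le hT'T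
  refine ⟨δ₀, h, k, hδ₀0, hhc, hh0, fun u x hx0 hxδ => ?_, fun c hc0 hcδ => ?_⟩
  · obtain ⟨hpc, -, -, hkh, hhk', hpk, -⟩ := hhk u x hx0 hxδ
    exact ⟨hpc, hkh, hhk', hpk⟩
  ------------------------------------------------------------------
  -- (7) the local-monodromy datum of the member `X_c`
  ------------------------------------------------------------------
  have hcρ : ‖c‖ < ρW := lt_of_lt_of_le hcδ hδρ
  -- the rescaling roots `λ₀² = λ₁² = λ₂^p = c`
  obtain ⟨z₂, hz₂⟩ := IsAlgClosed.exists_pow_nat_eq c two_pos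
  obtain ⟨zp, hzp⟩ := IsAlgClosed.exists_pow_nat_eq c hd
  let lam : Fin (1 + 2) → ℂ := ![z₂, z₂, zp]
  have hlam : ∀ i, lam i ^ PhamBrieskorn.cyclicNodeExponents p i = c := by
    intro i
    fin_cases i <;> simp [lam, PhamBrieskorn.cyclicNodeExponents, hz₂, hzp]
  have hcτ : ‖c‖ < τ ^ p := lt_of_lt_of_le hcδ hδ₀τ
  have hτp : τ ^ p ≤ τ := pow_le_of_le_one hτ0.le hτ1 hp0
  have hz₂n : ‖z₂‖ ^ 2 < T' / 3 := by
    rw [← norm_pow, hz₂]; linarith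
  have hzpn : ‖zp‖ ^ 2 < T' / 3 := by
    have h1 : ‖zp‖ ^ p < τ ^ p := by rw [← norm_pow, hzp]; exact hcτ
    have h2 : ‖zp‖ < τ := lt_of_pow_lt_pow_left₀ p hτ0.le h1
    have h3 : ‖zp‖ ^ 2 ≤ ‖zp‖ := pow_le_of_le_one (norm_nonneg _) (h2.le.trans hτ1) two_ne_zero
    linarith
  have hlamT : ∑ i, ‖lam i‖ ^ 2 < T' := by
    rw [Fin.sum_univ_three]
    simp only [lam, Matrix.cons_val_zero, Matrix.cons_val_one, Matrix.cons_val]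
    linarith
  -- the time-one map and the homotopy
  have hh₁c : Continuous fun x : {x : pencilSlice p // pencilCoord p x.1 ≠ 0} => h (1, x.1) :=
    hhc.comp (continuous_const.prodMk continuous_id)
  have h2π : Complex.exp (((2 * π * (1 : ℝ) : ℝ) : ℂ) * I) = 1 := by
    rw [mul_one, show (((2 * π : ℝ)) : ℂ) * I = 2 * π * I by push_cast; ring]; exact Complex.exp_two_pi_mul_I
  have hh₁pc : ∀ x : pencilSlice p, pencilCoord p x.1 ≠ 0 → ‖pencilCoord p x.1‖ < δ₀ →
      pencilCoord p (h (1, x)).1 = pencilCoord p x.1 := fun x hx0 hxδ => by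
    rw [(hhk 1 x hx0 hxδ).1, h2π, one_mul]
  have hh₁F : ∀ x : pencilSlice p, pencilCoord p x.1 ≠ 0 → ‖pencilCoord p x.1‖ < δ₀ → satRadius p Θ R''' R'' x.1 < T →
      satRadius p Θ R''' R'' (h (1, x)).1 = satRadius p Θ R''' R'' x.1 := fun x hx0 hxδ hF => (hhk 1 x hx0 hxδ).2.1 hF
  have hh₁id : ∀ x : pencilSlice p, pencilCoord p x.1 ≠ 0 → ‖pencilCoord p x.1‖ < δ₀ → t₂ ≤ satRadius p Θ R''' R'' x.1 →
      h (1, x) = x := fun x hx0 hxδ hF => hh1 x hx0 hxδ hF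
  have hH' : ∀ (s : ℝ) (x : pencilSlice p), pencilCoord p x.1 ≠ 0 → ‖pencilCoord p x.1‖ < δ₀ → satRadius p Θ R''' R'' x.1 < T →
      pencilCoord p (H (s, x)).1 = pencilCoord p x.1 ∧
      satRadius p Θ R''' R'' (H (s, x)).1 = satRadius p Θ R''' R'' x.1 ∧
      (H (0, x)).1 = chartModelIsotopy (PhamBrieskorn.cyclicNodeExponents p) Φ Θ (2 * π) x.1 ∧
      (satRadius p Θ R''' R'' x.1 ≤ T' → H (1, x) = (fun x => h (1, x)) x) := fun s x hx0 hxδ hF => hH s x hx0 hxδ hF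
  obtain ⟨hY, hYval, hdat⟩ := localMonodromy_datum hp Φ hΦ hΦs hΦt Θ hrt hΘ hR''t hΘφ hns hR hTR hTr ht₂T' hT'T hδρ
    (fun x => h (1, x)) hh₁c hh₁pc hh₁F hh₁id H hHc hH' hc0 hcδ lam hlam hlamT
  exact ⟨hY, hYval, hdat⟩

end Literature.AlgebraicGeometry.HodgeTheory.CyclicCoverMonodromy.NodalPencilPackage

end

/-! ## Part 2: The rational transport datum of the pencil circle -/

noncomputable section

open _root_.CategoryTheory _root_.AlgebraicGeometry MvPolynomial TopologicalSpace Set _root_.Topology Filter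
open scoped Real unitInterval
open Literature.AlgebraicGeometry.Motives Literature.AlgebraicGeometry.Motives.UniversalHypersurface
open Literature.AlgebraicGeometry.HodgeTheory Literature.AlgebraicGeometry.HodgeTheory.UniversalHypersurface
open Literature.Geometry.ComplexAnalytic Literature.Geometry.Manifold
open Literature.AlgebraicTopology.SingularHomology
open Literature.AlgebraicGeometry.HodgeTheory.CyclicCoverMonodromy.NodalPencilPackage

namespace Literature.AlgebraicGeometry.HodgeTheory.CyclicCoverMonodromy.NodalPencilCircleDatum

/-! ### §1 The datum passes to the inverse -/

section Inverse

variable {K : Type*} [Field K] {V : Type*} [AddCommGroup V] [Module K V]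

/-- `Tⁱ (T⁻ⁱ v) = v`. [cite: CarlsonToledo1999, §6 (kdoublept)] -/
theorem pow_apply_symm_pow_apply (T : V ≃ₗ[K] V) (i : ℕ) (v : V) : (T ^ i) ((T.symm ^ i) v) = v := by
  induction i generalizing v with
  | zero => simp
  | succ i ih => rw [pow_succ, pow_succ', LinearEquiv.mul_apply, LinearEquiv.mul_apply, T.apply_symm_apply, ih]

/-- **The local-monodromy datum passes to the inverse**: if `T x − x ∈ U` for all `x` and `Σ_{i<p} Tⁱ = 0` on `U`, then the same
holds for `T⁻¹` with the same `U` (`T⁻¹x − x = −(Ty − y)` for `y = T⁻¹x`; `T^{p−1} Σ T^{−i} v = Σ T^{p−1−i} v = 0`).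
[cite: CarlsonToledo1999, §6 (kdoublept) (held text p0013–p0014)] -/
theorem exists_localMonodromyDatum_symm {p m : ℕ} (T : V ≃ₗ[K] V)
    (h : ∃ U : Submodule K V, (∀ x, T x - x ∈ U) ∧ (∀ v ∈ U, (∑ i ∈ Finset.range p, (T ^ i) v) = 0) ∧
      Module.finrank K U ≤ m) :
    ∃ U : Submodule K V, (∀ x, T.symm x - x ∈ U) ∧ (∀ v ∈ U, (∑ i ∈ Finset.range p, (T.symm ^ i) v) = 0) ∧
      Module.finrank K U ≤ m := by
  obtain ⟨U, hU₁, hU₂, hU₃⟩ := h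
  refine ⟨U, fun x => ?_, fun v hv => ?_, hU₃⟩
  · have h1 := U.neg_mem (hU₁ (T.symm x))
    rwa [T.apply_symm_apply, neg_sub] at h1
  · -- apply the injective `T^{p-1}`
    apply (T ^ (p - 1)).injective
    rw [map_sum, map_zero]
    have hterm : ∀ i ∈ Finset.range p, (T ^ (p - 1)) ((T.symm ^ i) v) = (T ^ (p - 1 - i)) v := by
      intro i hi
      have hi' : i < p := Finset.mem_range.mp hi
      have hsplit : T ^ (p - 1) = T ^ (p - 1 - i) * T ^ i := by rw [← pow_add]; congr 1; omega
      rw [hsplit, LinearEquiv.mul_apply, pow_apply_symm_pow_apply]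
    rw [Finset.sum_congr rfl hterm, Finset.sum_range_reflect (fun j => (T ^ j) v) p]
    exact hU₂ v hv

end Inverse

/-! ### §2 The circle datum -/

/-- **The rational transport along a small circle of the nodal pencil exists and carries the local-monodromy datum.** For
`p ≥ 3` there is `ε₀ > 0` such that for every `0 < |ε| < ε₀` and every loop `γ₀` at `s₀` in the base of the Carlson–Toledo family
with `b(γ₀ u) = b(x₃^p − f₁) − e^{2πiu}ε·e_{x₂^p}`: there are a rational transport `T` of `R²u_*ℚ` along `cyclicCoverLoopClass p γ₀`
and a subspace `V ⊆ H²(X_{s₀}(ℂ); ℚ)` with `(T − 1)H² ⊆ V`, `Σ_{i<p} Tⁱ|_V = 0`, `dim V ≤ p − 1`.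
[cite: CarlsonToledo1999, §6 (kdoublept) (held text p0013–p0014)] [cite: VoisinHodgeI2002, §9.2.1 and Prop. 9.5]
[cite: ArnoldGuseinzadeVarchenko2012, Part I §1.1 and §2.1] -/
theorem exists_isRatTransport_datum_pencilCircle {p : ℕ} [NeZero p] (hp : 3 ≤ p) :
    ∃ ε₀ : ℝ, 0 < ε₀ ∧ ∀ (ε : ℂ), ε ≠ 0 → ‖ε‖ < ε₀ →
      ∀ {s₀ : ComplexPoints (cyclicCoverBase p)} (γ₀ : Path s₀ s₀),
        (∀ u : I, coeffVector ℂ 2 p (AlgPoints.map (toBaseSpz ℂ 2 p (cyclicCoverSpz p)) (γ₀ u)) =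
          coeffsOf 2 p (cyclicCoverForm p (X 2 ^ (p - 2) * (X 0 * X 1) + X 0 ^ p + X 1 ^ p)) -
            Pi.single (regPowIndex 2 p 2) (Complex.exp (((2 * π * u : ℝ) : ℂ) * Complex.I) * ε)) →
        ∃ (T : bettiCohomology (fiberOver (cyclicCoverFamily p) s₀) 2 ≃ₗ[ℚ] bettiCohomology (fiberOver (cyclicCoverFamily p) s₀) 2)
          (V : Submodule ℚ (bettiCohomology (fiberOver (cyclicCoverFamily p) s₀) 2)),
          IsRatTransport (cyclicCoverFamily p) 2 (cyclicCoverFamily_locallyTrivial p) (cyclicCoverLoopClass p γ₀) T ∧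
          (∀ x, T x - x ∈ V) ∧ (∀ v ∈ V, (∑ i ∈ Finset.range p, (T ^ i) v) = 0) ∧ Module.finrank ℚ V ≤ p - 1 := by
  obtain ⟨δ₀, h, k, hδ₀, hhc, hh0, hhk, hdat⟩ := exists_nodalPencil_monodromy_package hp
  refine ⟨δ₀, hδ₀, fun ε hε0 hεδ s₀ γ₀ hγ => ?_⟩
  -- the transport along the circle is `r^*`, `r` the inverse holonomy read in the fibre
  obtain ⟨f, r, T, hfr, hrf, hfr', hT, hTr⟩ := exists_isRatTransport_pencilCircle hp h k hhc hh0 hhk hε0 hεδ γ₀ hγ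
  -- the datum of the time-one map on the member `X_ε`
  obtain ⟨hY, hYval, hdatY⟩ := hdat ε hε0 hεδ
  -- notation for the spaces
  have hs₀ := transport_coeff_base γ₀ hγ
  have hset : {Q : ComplexPoints (regularTotal ℂ 2 p) |
      regCoeff ℂ 2 p Q = coeffVector ℂ 2 p (AlgPoints.map (toBaseSpz ℂ 2 p (cyclicCoverSpz p)) s₀)} = pencilFibre p ε := by
    ext Q; rw [mem_setOf_eq, mem_pencilFibre_iff_regCoeff_eq hp, hs₀]
  let Ψ : ComplexPoints (fiberOver (cyclicCoverFamily p) s₀) ≃ₜ ↥(pencilFibre p ε) :=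
    (cycFibreHomeo p s₀).trans (Homeomorph.setCongr hset)
  have hΨval : ∀ y, ((Ψ y : ↥(pencilFibre p ε)) : ComplexPoints (regularTotal ℂ 2 p)) = cycFibreToReg p s₀ y := fun y => rfl
  -- `f = Ψ⁻¹ ∘ hY ∘ Ψ`
  have hfΨ : ∀ y, Ψ (f y) = hY (Ψ y) := by
    intro y
    obtain ⟨hy, hfy, -⟩ := hfr y
    apply Subtype.ext
    rw [hΨval, hfy, hYval]
    rfl
  -- the homeomorphism `f` (inverse `r`) and the induced homeomorphism of `X_ε`
  let ηY : ComplexPoints (fiberOver (cyclicCoverFamily p) s₀) ≃ₜ ComplexPoints (fiberOver (cyclicCoverFamily p) s₀) :=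
    { toFun := f, invFun := r, left_inv := hrf, right_inv := hfr', continuous_toFun := f.continuous,
      continuous_invFun := r.continuous }
  let ηX : ↥(pencilFibre p ε) ≃ₜ ↥(pencilFibre p ε) := Ψ.symm.trans (ηY.trans Ψ)
  have hηX : (ηX : C(↥(pencilFibre p ε), ↥(pencilFibre p ε))) = hY := by
    refine ContinuousMap.ext fun x => ?_
    change Ψ (f (Ψ.symm x)) = hY x
    rw [hfΨ, Ψ.apply_symm_apply]
  -- the datum of `τX = hY^*` and of its inverse
  let τX : singularCohomology ℚ ℚ ↥(pencilFibre p ε) 2 ≃ₗ[ℚ] singularCohomology ℚ ℚ ↥(pencilFibre p ε) 2 :=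
    (singularCohomology.mapIso ℚ ℚ ηX 2).toLinearEquiv
  have hτX : ∀ x, τX x = (singularCohomology.map ℚ ℚ hY 2).hom x := fun x => by
    change (singularCohomology.mapIso ℚ ℚ ηX 2).hom x = _
    rw [singularCohomology.mapIso_hom, hηX]
  have hdatX := hdatY τX hτX
  have hdatX' := exists_localMonodromyDatum_symm τX hdatX
  -- conjugation by `A = (Ψ⁻¹)^* : H²(X_{s₀}(ℂ)) ≃ H²(X_ε)`
  haveI : Module.Finite ℚ (bettiCohomology (fiberOver (cyclicCoverFamily p) s₀) 2) :=
    BettiUniverse.finite ((isSmoothProjectiveFamily_cyclicCoverFamily p).isSmoothProjective s₀) 2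
  let A : bettiCohomology (fiberOver (cyclicCoverFamily p) s₀) 2 ≃ₗ[ℚ] singularCohomology ℚ ℚ ↥(pencilFibre p ε) 2 :=
    (singularCohomology.mapIso ℚ ℚ Ψ.symm 2).toLinearEquiv
  haveI : FiniteDimensional ℚ (singularCohomology ℚ ℚ ↥(pencilFibre p ε) 2) := Module.Finite.equiv A
  obtain ⟨U, hU₁, hU₂, hU₃⟩ := exists_localMonodromyDatum_of_conj (p := p) (m := p - 1) τX.symm A hdatX'
  -- `r = Ψ⁻¹ ∘ ηX⁻¹ ∘ Ψ`
  have hr : r = (Ψ.symm : C(↥(pencilFibre p ε), ComplexPoints (fiberOver (cyclicCoverFamily p) s₀))).comp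
      ((ηX.symm : C(↥(pencilFibre p ε), ↥(pencilFibre p ε))).comp (Ψ.symm.symm : C(ComplexPoints (fiberOver (cyclicCoverFamily p) s₀), ↥(pencilFibre p ε)))) := by
    refine ContinuousMap.ext fun y => ?_
    change r y = Ψ.symm (Ψ (ηY.symm (Ψ.symm (Ψ.symm.symm y))))
    change r y = Ψ.symm (Ψ (r (Ψ.symm (Ψ y))))
    rw [Ψ.symm_apply_apply, Ψ.symm_apply_apply]
  -- `T = A⁻¹ τX⁻¹ A` pointwise
  have hTconj : ∀ v, T v = (A.trans (τX.symm.trans A.symm)) v := by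
    intro v
    rw [hTr v, LinearEquiv.trans_apply, LinearEquiv.trans_apply]
    change _ = (singularCohomology.mapIso ℚ ℚ Ψ.symm 2).inv
      ((singularCohomology.mapIso ℚ ℚ ηX 2).toLinearEquiv.symm ((singularCohomology.mapIso ℚ ℚ Ψ.symm 2).hom v))
    rw [Iso.toLinearEquiv_symm, Iso.toLinearEquiv_apply, Iso.symm_hom, singularCohomology.mapIso_inv,
      singularCohomology.mapIso_inv, singularCohomology.mapIso_hom, ← ModuleCat.comp_apply, ← ModuleCat.comp_apply,
      ← singularCohomology.map_comp, ← singularCohomology.map_comp]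
    exact congrArg (fun g : C(ComplexPoints (fiberOver (cyclicCoverFamily p) s₀), ComplexPoints (fiberOver (cyclicCoverFamily p) s₀)) => (singularCohomology.map ℚ ℚ g 2).hom v) hr
  refine ⟨T, U, hT, fun x => ?_, fun v hv => ?_, hU₃⟩
  · rw [hTconj]; exact hU₁ x
  · have hpow : ∀ i, (T ^ i) v = ((A.trans (τX.symm.trans A.symm)) ^ i) v := fun i => by
      have hTeq : T = A.trans (τX.symm.trans A.symm) := LinearEquiv.ext hTconj
      rw [hTeq]
    simp_rw [hpow]
    exact hU₂ v hv

end Literature.AlgebraicGeometry.HodgeTheory.CyclicCoverMonodromy.NodalPencilCircleDatum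

end
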